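import Summits.AtomisticToContinuum.HydrodynamicLimit.Theorems.AntiMazurCoboundariesCorrectorPressureDecayKiferEntropyUniformShearer
import Literature.MathematicalPhysics.KineticTheory.HardSphereEulerProofs
import Mathlib.InformationTheory.KullbackLeibler.Basic
import Mathlib.MeasureTheory.Constructions.Pi

/-!
# Entropy bound for tangent states, VII: the chain rule of the relative entropy for product references (line `FirstLemma`, crux stmt-AtomisticToContinuum-14135)

Helper file of the registered stub `c9_klDiv_pi_eq_klDiv_pi_marginals_add_sum` (lead seat c9, Gibbs route of the
uniform entropy bound), namespace `Summit.AtomisticToContinuum.HydrodynamicLimit.Theorems.KiferCompactification`.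

In the Gibbs route of the line's entropy bound a probability law `Q` on configurations is cut into finitely many
cells; against a PRODUCT reference `⨂ⱼ Rⱼ` (free finite-volume Gibbs measures on the cells) the cell inequality
`∑ⱼ KL(Qⱼ ‖ Rⱼ) ≤ KL(Q ‖ G_N) + c_N` holds with the `Q`-independent constant `c_N = KL(G'_N ‖ ⨂ⱼ Rⱼ)`. The chain
rule of this file splits that constant into the multi-information of `G'_N` plus the free-energy terms:

* `c9_klDiv_pi_eq_klDiv_pi_marginals_add_sum` — for a probability law `P` on `Π i, E i` with marginals
  `Pᵢ = P.map (eval i)` and probability laws `Rᵢ`: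
  `KL(P ‖ ⨂ᵢ Rᵢ) = KL(P ‖ ⨂ᵢ Pᵢ) + ∑ᵢ KL(Pᵢ ‖ Rᵢ)` in `ℝ≥0∞` (Csiszár; Cover–Thomas Thm 2.5.3 in the discrete case),
  with Mathlib's conventions (`klDiv μ ν = ∞` unless `μ ≪ ν` and `llr μ ν` is `μ`-integrable).

Proof. If some `KL(Pᵢ ‖ Rᵢ) = ∞` both sides are `∞` by the superadditivity `sum_klDiv_map_eval_le_klDiv_pi`
(`…KiferEntropyUniformShearer.lean`). Otherwise `Pᵢ ≪ Rᵢ` with densities `fᵢ`, and `⨂ Pᵢ = (∏ᵢ fᵢ(xᵢ)) · ⨂ Rᵢ`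
(`pi_eq_withDensity_prod_rnDeriv`, from the tree's `Literature.MathematicalPhysics.KineticTheory.pi_withDensity_eq`), so
`⨂ Pᵢ ≪ ⨂ Rᵢ` with density `∏ᵢ fᵢ(xᵢ)`; since `∏ᵢ fᵢ(xᵢ) ≠ 0` `P`-a.e., also `P ≪ ⨂ Rᵢ → P ≪ ⨂ Pᵢ`
(`absolutelyContinuous_pi_of_absolutelyContinuous_pi`), so lack of absolute continuity makes both sides `∞`.
In the absolutely continuous case the chain rule of Radon–Nikodym derivatives gives
`llr P (⨂ Rᵢ) = llr P (⨂ Pᵢ) + ∑ᵢ llr Pᵢ Rᵢ ∘ eval i` `P`-a.e. (`llr_pi_ae_eq_add_sum`), the sum being `P`-integrable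
with integral `∑ᵢ KL(Pᵢ ‖ Rᵢ)`; hence the two log-likelihood ratios are integrable simultaneously and the identity
follows by integrating.

Design. Mathlib's chain rule `InformationTheory.klDiv_compProd_eq_add` is stated for composition-products `μ ⊗ₘ κ` of a
measure with a Markov kernel; using it here would need a disintegration of `P` along each coordinate (standard Borel
blocks). The present Radon–Nikodym route works on arbitrary measurable spaces. The by-products
`pi_eq_withDensity_prod_rnDeriv`, `absolutelyContinuous_pi_pi`, `rnDeriv_pi_ae_eq`,
`absolutelyContinuous_pi_of_absolutelyContinuous_pi`, `llr_pi_ae_eq_add_sum` are public (sigma-finite blocks).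
Tonelli for `Measure.pi` (`lintegral_fintype_prod_eq_prod'`, `pi_withDensity_eq`) is imported from
`Literature.MathematicalPhysics.KineticTheory.HardSphereEulerProofs`, already a transitive import of the line file.
-/

noncomputable section

open MeasureTheory ProbabilityTheory Set Filter Topology InformationTheory
open scoped ENNReal NNReal

namespace Summit.AtomisticToContinuum.HydrodynamicLimit.Theorems.KiferCompactification

section PiDensity

variable {ι : Type*} [Fintype ι] {E : ι → Type*} [∀ i, MeasurableSpace (E i)]

/-- The product of the Radon–Nikodym densities of the factors is measurable on the product space. -/
theorem measurable_prod_rnDeriv_eval (μ ν : ∀ i, Measure (E i)) :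
    Measurable fun x : ∀ i, E i => ∏ i, (μ i).rnDeriv (ν i) (x i) :=
  Finset.measurable_prod _ fun i _ => (Measure.measurable_rnDeriv _ _).comp (measurable_pi_apply i)

/-- **Product of absolutely continuous measures.** If `μ i ≪ ν i` for every block, the product measure
`⨂ᵢ μᵢ` is the product reference `⨂ᵢ νᵢ` with density `x ↦ ∏ᵢ (dμᵢ/dνᵢ)(xᵢ)`. -/
theorem pi_eq_withDensity_prod_rnDeriv (μ ν : ∀ i, Measure (E i)) [∀ i, SigmaFinite (μ i)]
    [∀ i, SigmaFinite (ν i)] (h : ∀ i, μ i ≪ ν i) :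
    Measure.pi μ = (Measure.pi ν).withDensity fun x => ∏ i, (μ i).rnDeriv (ν i) (x i) := by
  have hμ : (fun i => (ν i).withDensity ((μ i).rnDeriv (ν i))) = μ :=
    funext fun i => Measure.withDensity_rnDeriv_eq _ _ (h i)
  have hσ : ∀ i, SigmaFinite ((ν i).withDensity ((μ i).rnDeriv (ν i))) := fun i => by
    rw [Measure.withDensity_rnDeriv_eq _ _ (h i)]; infer_instance
  have hpi := Literature.MathematicalPhysics.KineticTheory.pi_withDensity_eq ν
    (fun i => Measure.measurable_rnDeriv (μ i) (ν i)) hσ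
  rwa [hμ] at hpi

/-- A finite product of absolutely continuous measures is absolutely continuous with respect to the product
of the dominating measures. -/
theorem absolutelyContinuous_pi_pi {μ ν : ∀ i, Measure (E i)} [∀ i, SigmaFinite (μ i)]
    [∀ i, SigmaFinite (ν i)] (h : ∀ i, μ i ≪ ν i) : Measure.pi μ ≪ Measure.pi ν := by
  rw [pi_eq_withDensity_prod_rnDeriv μ ν h]
  exact withDensity_absolutelyContinuous _ _

/-- **Radon–Nikodym derivative of a product.** If `μ i ≪ ν i` for every block,
`d(⨂ᵢ μᵢ)/d(⨂ᵢ νᵢ) (x) = ∏ᵢ (dμᵢ/dνᵢ)(xᵢ)` for `⨂ᵢ νᵢ`-a.e. `x`. -/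
theorem rnDeriv_pi_ae_eq (μ ν : ∀ i, Measure (E i)) [∀ i, SigmaFinite (μ i)] [∀ i, SigmaFinite (ν i)]
    (h : ∀ i, μ i ≪ ν i) :
    (Measure.pi μ).rnDeriv (Measure.pi ν) =ᵐ[Measure.pi ν] fun x => ∏ i, (μ i).rnDeriv (ν i) (x i) := by
  rw [pi_eq_withDensity_prod_rnDeriv μ ν h]
  exact Measure.rnDeriv_withDensity _ (measurable_prod_rnDeriv_eval μ ν)

/-- **Transfer of absolute continuity between product references.** If `μ i ≪ ν i`, the marginals of `P`
satisfy `P.map (eval i) ≪ μ i`, and `P ≪ ⨂ᵢ νᵢ`, then `P ≪ ⨂ᵢ μᵢ`: a `⨂ μᵢ`-null set is, up to a `⨂ νᵢ`-null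
set, contained in `{∏ᵢ (dμᵢ/dνᵢ)(xᵢ) = 0}`, which is `P`-null because each density is positive `μᵢ`-a.e. -/
theorem absolutelyContinuous_pi_of_absolutelyContinuous_pi (P : Measure (∀ i, E i))
    (μ ν : ∀ i, Measure (E i)) [∀ i, SigmaFinite (μ i)] [∀ i, SigmaFinite (ν i)] (hμν : ∀ i, μ i ≪ ν i)
    (hPμ : ∀ i, P.map (Function.eval i) ≪ μ i) (hP : P ≪ Measure.pi ν) : P ≪ Measure.pi μ := by
  -- the product density does not vanish `P`-a.e.
  have h0 : ∀ᵐ x ∂P, (∏ i, (μ i).rnDeriv (ν i) (x i)) ≠ 0 := by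
    have h : ∀ i, ∀ᵐ x ∂P, (μ i).rnDeriv (ν i) (x i) ≠ 0 := fun i =>
      ae_of_ae_map (measurable_pi_apply i).aemeasurable ((hPμ i).ae_le
        ((Measure.rnDeriv_pos (hμν i)).mono fun _ hy => hy.ne'))
    filter_upwards [eventually_all.2 h] with x hx
    exact Finset.prod_ne_zero_iff.2 fun i _ => hx i
  refine Measure.AbsolutelyContinuous.mk fun N hN hμN => ?_
  rw [pi_eq_withDensity_prod_rnDeriv μ ν hμν, withDensity_apply _ hN,
    lintegral_eq_zero_iff (measurable_prod_rnDeriv_eval μ ν)] at hμN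
  have h1 : ∀ᵐ x ∂Measure.pi ν, x ∈ N → (∏ i, (μ i).rnDeriv (ν i) (x i)) = 0 := by
    have h := (ae_restrict_iff' hN).1 hμN
    filter_upwards [h] with x hx hxN using by simpa using hx hxN
  rw [measure_eq_zero_iff_ae_notMem]
  filter_upwards [hP.ae_le h1, h0] with x h1 h0 hxN using h0 (h1 hxN)

/-- **Chain rule for the log-likelihood ratio against two product references.** If `μ i ≪ ν i` and
`P ≪ ⨂ᵢ μᵢ`, then `P`-a.e. `llr P (⨂ νᵢ) = llr P (⨂ μᵢ) + ∑ᵢ llr μᵢ νᵢ ∘ eval i` (chain rule of Radon–Nikodym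
derivatives; all densities are positive and finite `P`-a.e.). -/
theorem llr_pi_ae_eq_add_sum (P : Measure (∀ i, E i)) [SigmaFinite P] (μ ν : ∀ i, Measure (E i))
    [∀ i, SigmaFinite (μ i)] [∀ i, SigmaFinite (ν i)] (hμν : ∀ i, μ i ≪ ν i) (hP : P ≪ Measure.pi μ) :
    llr P (Measure.pi ν) =ᵐ[P] fun x => llr P (Measure.pi μ) x + ∑ i, llr (μ i) (ν i) (x i) := by
  have hPν : P ≪ Measure.pi ν := hP.trans (absolutelyContinuous_pi_pi hμν)
  -- chain rule of Radon–Nikodym derivatives, `P`-a.e.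
  have hchain : ∀ᵐ x ∂P, P.rnDeriv (Measure.pi ν) x =
      P.rnDeriv (Measure.pi μ) x * ∏ i, (μ i).rnDeriv (ν i) (x i) := by
    filter_upwards [hPν.ae_le (Measure.rnDeriv_mul_rnDeriv hP (κ := Measure.pi ν)),
      hPν.ae_le (rnDeriv_pi_ae_eq μ ν hμν)] with x h1 h2
    rw [← h1, Pi.mul_apply, h2]
  -- positivity and finiteness of the factors, `P`-a.e.
  have hpos : ∀ᵐ x ∂P, 0 < P.rnDeriv (Measure.pi μ) x := Measure.rnDeriv_pos hP
  have hlt : ∀ᵐ x ∂P, P.rnDeriv (Measure.pi μ) x < ∞ := hP.ae_le (Measure.rnDeriv_lt_top _ _)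
  have hfac : ∀ i, ∀ᵐ x ∂P, 0 < (μ i).rnDeriv (ν i) (x i) ∧ (μ i).rnDeriv (ν i) (x i) < ∞ := by
    intro i
    have hPi : P.map (Function.eval i) ≪ μ i :=
      (hP.map (measurable_pi_apply i)).trans (Measure.quasiMeasurePreserving_eval μ i).absolutelyContinuous
    have h : ∀ᵐ y ∂(μ i), 0 < (μ i).rnDeriv (ν i) y ∧ (μ i).rnDeriv (ν i) y < ∞ := by
      filter_upwards [Measure.rnDeriv_pos (hμν i), (hμν i).ae_le (Measure.rnDeriv_lt_top (μ i) (ν i))]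
        with y h1 h2
      exact ⟨h1, h2⟩
    exact ae_of_ae_map (measurable_pi_apply i).aemeasurable (hPi.ae_le h)
  filter_upwards [hchain, hpos, hlt, eventually_all.2 hfac] with x hx h0 htop hf
  have hne : ∀ i, ((μ i).rnDeriv (ν i) (x i)).toReal ≠ 0 := fun i =>
    (ENNReal.toReal_pos (hf i).1.ne' (hf i).2.ne).ne'
  simp only [llr]
  rw [hx, ENNReal.toReal_mul, ENNReal.toReal_prod,
    Real.log_mul (ENNReal.toReal_pos h0.ne' htop.ne).ne' (Finset.prod_ne_zero_iff.2 fun i _ => hne i),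
    Real.log_prod (fun i _ => hne i)]

end PiDensity

/-- **Chain rule of the relative entropy for product references.** For a probability law `P` on `Π i, E i`
with marginals `Pᵢ = P.map (eval i)` and probability laws `Rᵢ` on the blocks:
`KL(P ‖ ⨂ᵢ Rᵢ) = KL(P ‖ ⨂ᵢ Pᵢ) + ∑ᵢ KL(Pᵢ ‖ Rᵢ)` — the entropy relative to a product reference is the
multi-information of `P` plus the marginal entropies. Registered stub of line `FirstLemma`
(crux stmt-AtomisticToContinuum-14135), lead seat c9. -/
theorem c9_klDiv_pi_eq_klDiv_pi_marginals_add_sum {ι : Type*} [Fintype ι] {E : ι → Type*}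
    [∀ i, MeasurableSpace (E i)] (P : Measure (∀ i, E i)) [IsProbabilityMeasure P]
    (R : ∀ i, Measure (E i)) [∀ i, IsProbabilityMeasure (R i)] :
    klDiv P (Measure.pi R) =
      klDiv P (Measure.pi fun i => P.map (Function.eval i)) + ∑ i, klDiv (P.map (Function.eval i)) (R i) := by
  haveI hPi : ∀ i, IsProbabilityMeasure (P.map (Function.eval i)) := fun i =>
    Measure.isProbabilityMeasure_map (measurable_pi_apply i).aemeasurable
  -- a marginal of infinite relative entropy makes both sides infinite (superadditivity)
  by_cases hinf : ∃ i, klDiv (P.map (Function.eval i)) (R i) = ∞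
  · obtain ⟨i, hi⟩ := hinf
    have hsum : ∑ j, klDiv (P.map (Function.eval j)) (R j) = ∞ :=
      ENNReal.sum_eq_top.2 ⟨i, Finset.mem_univ i, hi⟩
    have hL : klDiv P (Measure.pi R) = ∞ :=
      eq_top_iff.2 (hsum ▸ sum_klDiv_map_eval_le_klDiv_pi P R)
    rw [hL, hsum, add_top]
  have hfin : ∀ i, klDiv (P.map (Function.eval i)) (R i) ≠ ∞ := fun i h => hinf ⟨i, h⟩
  have hac : ∀ i, P.map (Function.eval i) ≪ R i := fun i => (klDiv_ne_top_iff.1 (hfin i)).1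
  have hint : ∀ i, Integrable (llr (P.map (Function.eval i)) (R i)) (P.map (Function.eval i)) := fun i =>
    (klDiv_ne_top_iff.1 (hfin i)).2
  have hMR : (Measure.pi fun i => P.map (Function.eval i)) ≪ Measure.pi R := absolutelyContinuous_pi_pi hac
  -- lack of absolute continuity makes both sides infinite
  by_cases hPρ : P ≪ Measure.pi R
  swap
  · have hPM : ¬ P ≪ Measure.pi fun i => P.map (Function.eval i) := fun h => hPρ (h.trans hMR)
    rw [klDiv_of_not_ac hPρ, klDiv_of_not_ac hPM, top_add]
  have hPM : P ≪ Measure.pi fun i => P.map (Function.eval i) :=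
    absolutelyContinuous_pi_of_absolutelyContinuous_pi P _ R hac
      (fun _ => Measure.AbsolutelyContinuous.rfl) hPρ
  -- the chain rule for the log-likelihood ratios, `P`-a.e., and integrability of the marginal part
  have hllr := llr_pi_ae_eq_add_sum P (fun i => P.map (Function.eval i)) R hac hPM
  have hgi : ∀ i, Integrable (fun x : ∀ i, E i => llr (P.map (Function.eval i)) (R i) (x i)) P := fun i =>
    (hint i).comp_measurable (measurable_pi_apply i)
  have hG : Integrable (fun x : ∀ i, E i => ∑ i, llr (P.map (Function.eval i)) (R i) (x i)) P :=
    integrable_finsetSum _ fun i _ => hgi i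
  -- lack of integrability makes both sides infinite
  by_cases hintρ : Integrable (llr P (Measure.pi R)) P
  swap
  · have hintM : ¬ Integrable (llr P (Measure.pi fun i => P.map (Function.eval i))) P := fun h =>
      hintρ ((integrable_congr hllr).2 (h.add hG))
    rw [klDiv_of_not_integrable hintρ, klDiv_of_not_integrable hintM, top_add]
  have hintM : Integrable (llr P (Measure.pi fun i => P.map (Function.eval i))) P :=
    (((integrable_congr hllr).1 hintρ).sub hG).congr (ae_of_all _ fun x => by simp)
  -- the good case: integrate the chain rule
  have hI : ∫ x, llr P (Measure.pi R) x ∂P = ∫ x, llr P (Measure.pi fun i => P.map (Function.eval i)) x ∂P +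
      ∑ i, ∫ y, llr (P.map (Function.eval i)) (R i) y ∂(P.map (Function.eval i)) := by
    rw [integral_congr_ae hllr, integral_add hintM hG, integral_finsetSum _ fun i _ => hgi i]
    congr 1
    refine Finset.sum_congr rfl fun i _ => ?_
    exact (integral_map (measurable_pi_apply i).aemeasurable (hint i).aestronglyMeasurable).symm
  have hLne : klDiv P (Measure.pi R) ≠ ∞ := klDiv_ne_top hPρ hintρ
  have hMne : klDiv P (Measure.pi fun i => P.map (Function.eval i)) ≠ ∞ := klDiv_ne_top hPM hintM
  have hSne : ∑ i, klDiv (P.map (Function.eval i)) (R i) ≠ ∞ := ENNReal.sum_ne_top.2 fun i _ => hfin i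
  refine (ENNReal.toReal_eq_toReal_iff' hLne (ENNReal.add_ne_top.2 ⟨hMne, hSne⟩)).1 ?_
  rw [ENNReal.toReal_add hMne hSne, ENNReal.toReal_sum fun i _ => hfin i,
    toReal_klDiv_of_measure_eq hPρ (by simp), toReal_klDiv_of_measure_eq hPM (by simp), hI]
  congr 1
  refine Finset.sum_congr rfl fun i _ => ?_
  rw [toReal_klDiv_of_measure_eq (hac i) (by simp)]

end Summit.AtomisticToContinuum.HydrodynamicLimit.Theorems.KiferCompactification

end
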